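import Summits.CriticalPhenomena.CardyFormulaZ2.Theorems.CardySusyWardParafermionFamiliesToSLESixIkhlefPonsaing
import Summits.CriticalPhenomena.CardyFormulaZ2.Theorems.CardySusyWardParafermionPrecompactFourClassTransferOfEdgePrecompact

/-!
# Negative lemma for crux `CardySusyWard.ParafermionPrecompact` (stmt-CriticalPhenomena-11293) modulo the
# uniform inner envelope

The crux AS TYPED (route file rev 5: clauses (i)/(ii) quantify `z z' : MedialVertex = Sym2 (Site 2)` with no
`edgeSet` guard) is kernel-equivalent to the local-uniform VANISHING of `δ^{-1/3} F_δ` and hence to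
`¬ Literature.Probability.LatticeModels.ParafermionBulkNondegenerate` (`parafermionPrecompact_iff_not_bulkNondegenerate`,
this directory, p74235).  Since 2026-08-17 the tree holds (line `strip-anchored-vertex-normalisation` of the sibling crux
stmt-CriticalPhenomena-10814, with Ikhlef–Ponsaing's first-passage law now the theorem
`Literature.Probability.Percolation.IkhlefPonsaingFirstPassage_holds`) the implication
`UniformInnerEnvelope → ¬ ParafermionPrecompact` (`StripAnchored.not_parafermionPrecompact_of_envelope`, p138858):
the moment identity of the diagonal anchor square makes the total spin-`1/3` vertex sum `≥ c δ^{-5/3}` unconditionally,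
the typed (vanishing) hypothesis kills its compact part, and the uniform inner envelope kills the boundary collar.

This file registers that implication as THIS item's negative lemma, in the gate's `<Decl>_false_of_<H>` shape, with
`H := UniformInnerEnvelope` — the junction statement of crux stmt-CriticalPhenomena-11387 (`CardyComplexCone.EdgePrecompact`,
registered stub `stub_uniformInnerEnvelope` of its line `qkz-strip-boundary-arm`; research core: the `δ^{1/12}` winding-phase
cancellation of Duminil-Copin–Smirnov's Conjecture 8.7 at `q = 1`).  It also records the resulting DICHOTOMY for the planner:
the same envelope that REFUTES the typed text is the input from which the sibling crux 11387 and the landed four-class transfer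
(`FourClassVertexTransfer.repairedAt_of_edgePrecompact`, p115329) PROVE the repaired text
`∀ D Λ, Negative.ParafermionPrecompactRepairedAt D Λ` (the rev-5 text with the two `edgeSet` guards).  So, whatever happens to the
envelope, the typed decl never closes `proved`: it closes `refuted` the day `UniformInnerEnvelope` lands.

References: H. Duminil-Copin, S. Smirnov, *Conformal invariance of lattice models*, Clay Math. Proc. 15 (2012), §8.3,
Prop. 8.6 and Conj. 8.7; Y. Ikhlef, A. K. Ponsaing, J. Stat. Phys. 149 (2012) 10–36, Prop. 4.7.
-/

namespace Summit.CriticalPhenomena.CardyFormulaZ2.Theorems.ParafermionPrecompact.Negative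

open Literature.Probability.LatticeModels (DiscreteDobrushin ParafermionBulkNondegenerate)
open Literature.Probability.RandomPlanarGeometry (DobrushinDomain)
open Summit.CriticalPhenomena.CardyFormulaZ2.Theses.CardySusyWard (ParafermionPrecompact)
open Summit.CriticalPhenomena.CardyFormulaZ2.Theses.CardyComplexCone (EdgePrecompact)
open Summit.CriticalPhenomena.CardyFormulaZ2.Cruxes.EdgePrecompact.QkzStripBoundaryArm (UniformInnerEnvelope)
open Summit.CriticalPhenomena.CardyFormulaZ2.Theorems.ParafermionFamiliesToSLESix (StripAnchored.not_parafermionPrecompact_of_envelope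
  StripAnchored.bulkNondegenerate_of_envelope)
open Summit.CriticalPhenomena.CardyFormulaZ2.Cruxes.ParafermionPrecompact (FourClassVertexTransfer.repairedAt_of_edgePrecompact)

/-- **NEGATIVE LEMMA (registered shape `<Decl>_false_of_<H>`).**  The uniform inner envelope of the spin-`1/3` corner
observable refutes the crux `CardySusyWard.ParafermionPrecompact` AS TYPED (whose unguarded clause (ii) is the vanishing
normalisation `δ^{-1/3}F_δ → 0` on compacts): glue over `StripAnchored.not_parafermionPrecompact_of_envelope` (p138858;
anchor-square moment identity + Ikhlef–Ponsaing first passage, a theorem of the tree). [folklore] -/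
theorem ParafermionPrecompact_false_of_UniformInnerEnvelope :
    UniformInnerEnvelope → ¬ ParafermionPrecompact :=
  StripAnchored.not_parafermionPrecompact_of_envelope

/-- Refuting the typed crux is EXACTLY proving Duminil-Copin–Smirnov's bulk non-degeneracy `H`
(`ParafermionBulkNondegenerate`, `[status: open]`): the contrapositive reading of
`parafermionPrecompact_iff_not_bulkNondegenerate` (p74235), recorded as an importable `Theorems` decl. [folklore] -/
theorem not_parafermionPrecompact_iff_bulkNondegenerate :
    ¬ ParafermionPrecompact ↔ ParafermionBulkNondegenerate := by
  rw [parafermionPrecompact_iff_not_bulkNondegenerate, not_not]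

/-- **The dichotomy under the envelope.**  `UniformInnerEnvelope` gives at once: (a) `H` (bulk non-degeneracy),
(b) the typed crux is FALSE, and (c) — through crux stmt-CriticalPhenomena-11387 `EdgePrecompact`, whose line takes the
same envelope as its junction — the REPAIRED crux `∀ D Λ, ParafermionPrecompactRepairedAt D Λ` (landed transfer p115329).
Stated with `EdgePrecompact` as an explicit second hypothesis, since `UniformInnerEnvelope → EdgePrecompact` is 11387's own
(open) composition. [folklore] -/
theorem dichotomy_of_uniformInnerEnvelope (hUIE : UniformInnerEnvelope) (hEP : EdgePrecompact) :
    ParafermionBulkNondegenerate ∧ ¬ ParafermionPrecompact ∧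
      ∀ (D : DobrushinDomain) (Λ : ℝ → DiscreteDobrushin), ParafermionPrecompactRepairedAt D Λ :=
  ⟨StripAnchored.bulkNondegenerate_of_envelope hUIE, ParafermionPrecompact_false_of_UniformInnerEnvelope hUIE,
    FourClassVertexTransfer.repairedAt_of_edgePrecompact hEP⟩

end Summit.CriticalPhenomena.CardyFormulaZ2.Theorems.ParafermionPrecompact.Negative
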